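import Summits.QuantumFields.YangMills.Theorems.BalabanUVNodesN18CombStepCovariant
import Summits.QuantumFields.YangMills.Theorems.BalabanUVNodesN18TwoBlockLoopStokes
import Summits.QuantumFields.YangMills.Theorems.BalabanUVNodesN18AvgPotentialCombGaugeLocal
import Literature.MathematicalPhysics.QuantumFieldTheory.Balaban1983to89.BlockAveragingSectionQsstar
import HarnessLib

/-!
# N18 (β)-transport letters: the C⁰ comb letter IN THE TORUS AXIAL GAUGE OF THE FACTOR — two-block-local hypotheses, no free gauge

[DAGN18W3-G5 INTENT-1] — count-neutral helper toward K3⁸ `stmt-QuantumFields-27366` (K3⁷ `stmt-QuantumFields-20544` aside; NOT claimed, NOT closed).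
YM mass gap (Clay) NOT proved by any of this; R4 closes the conditional finite-𝕋⁴ rung `BalabanLadder.UV` only.

WHY.  p626630 ★★★★ `norm_potential_add_combGrad_le_covariant` states the C⁰ comb letter of [Balaban1985Averaging] Prop. 3 ∕ (62)–(63) for run B's
factorisation `𝐔 = (exp iηA′)·U` in an ARBITRARY bi-contractive gauge `u` under the HYPOTHESIS `‖U^u(b) − 1‖ ≤ t` on ALL bonds of the fine torus.  No
gauge does that globally for a field that is only small modulo gauge ((1.11): small plaquettes).  This file discharges the hypothesis with Bałaban's axial
gauge ([Balaban1985Averaging] p. 24 «V₀ = V^{v₀} satisfies the conditions V₀(Γ_{y,x}) = 1») in its TORUS form `v₀ = B10Eq27TorusAxialLog.axialT U (emb c₋)`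
(the comb holonomy from the block centre `emb c₋`, read through the symmetric relative position `rel`), by CUTTING OFF AFTER GAUGING: the fields
`U₀ = χ·U^{v₀} + (1 − χ)·1`, `S₀ = χ·𝐔^{v₀} + (1 − χ)·1` (`χ` = the bonds of the two-block box `[−h,h]ᵈ + [0,L]e_μ` about `emb c₋`) are near-identity
factorised on ALL bonds, have the same (0.4) averages at `c` as `𝐔^{v₀}`, `U^{v₀}` (two-block locality, UST `Prop8Chart.emlAvgU_congr₂`) — hence, by exact
covariance (`avgUnits_mul_inv_gaugeU`) and `v₀(emb c₋) = 1`, the same quotient `Ū(𝐔)(c)Ū(U)(c)⁻¹` — and the same comb means at `c₋`, `c₊` (g2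
`combMean_congr_block`).  The smallness `‖U^{v₀}(b) − 1‖ ≤ |b₋ − emb c₋|₁·α ≤ ((d+2)L∕2)·α` on the box bonds is `B10Eq27TorusAxialLog.norm_holT_contourT_sub_one_le`
fed with p615425's pullback dictionary (`U1` on two-block bonds, plaquettes with four corners in the two blocks), applied to the factor cut off to `1`
off the two blocks (globally `U1`, same axial gauge on the two blocks: `axialT_congr_of_twoBlock`).

WHAT (ns `YMDAG.N18.TransportOfRecord`; `j + 2 ≤ m + K` — the two-block box must not wrap around the torus; true at the record, `m ≥ 1`, `K = k + 1`).
* §1 geometry: `transl_emb_off` (block site = centre + centred offset), `two_mul_sq_le_sitesPerDir`, `rel_emb_blockSite`, `rel_emb_blockSite_shift`,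
  `inBox_rel_of_twoBlock` (a two-block site has its relative position in the box), `noWrap_of_inBox`, `rel_tgt_of_twoBlock`.
* §2 the gauge: `axialT_mem_U1`, `agreeOn_pull_of_twoBlock`, `axialT_congr_of_twoBlock` (the axial gauge on the two blocks reads only two-block bonds),
  ★ `norm_gaugeU_axialT_sub_one_le_of_twoBlock` (`‖U^{v₀}(b) − 1‖ ≤ ((d+2)L∕2)·α` on two-block bonds, for globally `U1` fields — apply to the cut-off).
* §3 ★★ `norm_potential_add_combGrad_le_axial`: for `𝐔 = (exp iηA′)·U` on the two-block bonds of `c`, `|A′| ≤ a` there, `U ∈ U1` there, `‖∂U(p) − 1‖ ≤ α` on the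
  two-block plaquettes, `((d+2)L∕2)·α ≤ t` and p626630's numerics:
  `‖(iξ)⁻¹ log(Ū(𝐔)(c)·Ū(U)(c)⁻¹) + (η∕ξ)·(λ̄_{Ad(v₀)A′}(c₊) − λ̄_{Ad(v₀)A′}(c₋))‖ ≤ (η∕ξ)·L·a + R∕ξ`, `v₀ = axialT U (emb c₋)`, same `R` as p624650.
What is NOT here (successor): the comb generator `l` as a definition on run-A sites (`l(y) = iη·λ̄_{Ad(axialT U (emb y))A′}(y)`), the base change
`axialT U (emb c₋)` vs `axialT U (emb c₊)` on `B(c₊)`, FILE 7's exact `hrest` tuple, the C¹ letter.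

0 `def`, 0 `sorry`.  References: T. Bałaban, CMP **98** (1985) 17–51 [Balaban1985Averaging] ((8)–(9) pp.18–19, (11) p.19, (19)–(20) p.21, pp.24–25, (62)–(63) p.28,
(122)–(126) p.36); CMP **109** (1987) [Balaban1987RG1] ((0.1)–(0.4) pp.251–253, (1.10)–(1.13) p.262); CMP **102** (1985) [Balaban1985UV3] ((27) p.263).
-/

noncomputable section

open scoped BigOperators Matrix.Norms.L2Operator
open NormedSpace

namespace YMDAG.N18.TransportOfRecord

open Complex (I)
open Literature.MathematicalPhysics.QuantumFieldTheory.Balaban1983to89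
open Literature.MathematicalPhysics.QuantumFieldTheory.Balaban1983to89.T4Continuum
open Literature.MathematicalPhysics.QuantumFieldTheory.Balaban1983to89.BlockAveraging
open Literature.MathematicalPhysics.QuantumFieldTheory.Balaban1983to89.BlockAveragingEMLLinearised (combMean)
open Literature.MathematicalPhysics.QuantumFieldTheory.Balaban1983to89.B12RegularSpaces111 (expI gaugeU adJ plaq plaq_eq)
open Literature.MathematicalPhysics.QuantumFieldTheory.Balaban1983to89.B12RegularSpaces111Mono (expI_zero)
open Literature.MathematicalPhysics.QuantumFieldTheory.Balaban1983to89.MatrixLog (mlog)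
open Literature.MathematicalPhysics.QuantumFieldTheory.Balaban1983to89.B7Prop1Explicit renaming Site → LSite
open Literature.MathematicalPhysics.QuantumFieldTheory.Balaban1983to89.B7Prop1Explicit (e e_apply l1 U1 mem_U1 hol hol_mem treeWord plaqWord
  norm_inv_sub_one_le)
open Literature.MathematicalPhysics.QuantumFieldTheory.Balaban1983to89.B7Prop1Local (InBox PlaqIn AgreeOn hol_treeWord_congr)
open Literature.MathematicalPhysics.QuantumFieldTheory.Balaban1983to89.B10Eq27TorusAxialLog (transl transl_apply transl_add transl_add_e transl_zero pull
  pull_apply hol_pull hol_pull_zero holT rel rel_apply rel_transl_of_mem rel_shift_of_le axialT axialT_self holT_contourT_eq_gaugeActT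
  norm_holT_contourT_sub_one_le gaugeActT gaugeActT_apply)
open Literature.MathematicalPhysics.QuantumFieldTheory.Balaban1983to89.T4TermwiseBCH (norm_units_conj_le)
open Literature.MathematicalPhysics.QuantumFieldTheory.Balaban1983to89.Node00.W1 (avgUnits)
open Summit.QuantumFields.YangMills.Theorems.Prop8Chart (emlAvgU_congr₂)
open YMDAG.N18.BoxStokes (blockOf_transl_emb two_mul_l1_le_of_inBox twoBlockBox_lo_le_hi pull_mem_U1_of_twoBlock
  norm_hol_pull_plaqWord_sub_one_le_of_twoBlock inBox_add_e_of_inBox_add_add)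
open YMDAG.N18.AvgPotential (combMean_congr_block)
open Literature.MathematicalPhysics.QuantumFieldTheory.Balaban1983to89.BlockAveragingSectionQsstar (eq_blockSite_blockEquiv)

variable {P : Params} {j : ℕ}

/-! ## §1 Geometry: the relative positions of the two-block sites with respect to the centre `emb c₋` -/

section Geometry

/-- **A block site is the block centre displaced by the centred offset**: `blockSite y r = emb y + (r − (L−1)∕2)`. [cite: Balaban1987RG1, (0.3) p.252] -/
theorem transl_emb_off (y : Site P (j + 1)) (r : Fin P.d → Fin P.L) : transl (emb y) (off r) = Site.blockSite y r := by
  funext ν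
  rw [transl_apply]
  show (((y ν).val * P.L + (P.L - 1) / 2 : ℕ) : ZMod (P.sitesPerDir j)) + (((off r ν : ℤ)) : ZMod (P.sitesPerDir j)) =
    (((y ν).val * P.L + (r ν : ℕ) : ℕ) : ZMod (P.sitesPerDir j))
  rw [← Int.cast_natCast (R := ZMod (P.sitesPerDir j)) ((y ν).val * P.L + (P.L - 1) / 2), ← Int.cast_add,
    ← Int.cast_natCast (R := ZMod (P.sitesPerDir j)) ((y ν).val * P.L + (r ν : ℕ))]
  congr 1
  simp only [off]
  push_cast
  ring

/-- **No wrap-around room**: for `j + 2 ≤ m + K` the fine torus has `2L^{m+K−j} ≥ 2L²` sites per direction. [cite: Balaban1987RG1, (0.1) p.251] -/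
theorem two_mul_sq_le_sitesPerDir (hj2 : j + 2 ≤ P.m + P.K) : 2 * P.L ^ 2 ≤ P.sitesPerDir j := by
  unfold Params.sitesPerDir
  exact Nat.mul_le_mul_left 2 (Nat.pow_le_pow_right P.L_pos (by omega))

/-- The relative position of a block site with respect to its block centre is the centred offset (`|·| ≤ (L−1)∕2 <` half the period).
[cite: Balaban1987RG1, (0.3) p.252] -/
theorem rel_emb_blockSite (hj : j + 1 ≤ P.m + P.K) (y : Site P (j + 1)) (r : Fin P.d → Fin P.L) :
    rel (emb y) (Site.blockSite y r) = off r := by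
  rw [← transl_emb_off]
  refine rel_transl_of_mem _ _ fun ν => ?_
  have hL := AveragingRT.two_mul_half_add_one P
  have hn : P.sitesPerDir j = P.sitesPerDir (j + 1) * P.L := P.sitesPerDir_eq_mul_succ hj
  have hn1 : 1 ≤ P.sitesPerDir (j + 1) := Nat.one_le_iff_ne_zero.mpr (P.sitesPerDir_ne_zero _)
  have hnL : (P.L : ℤ) ≤ (P.sitesPerDir j : ℤ) := by
    have : P.L ≤ P.sitesPerDir j := by rw [hn]; nlinarith
    exact_mod_cast this
  have hb := off_bounds r ν
  constructor <;> omega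

/-- The relative position of a site of the NEXT block `B(y + e_μ)` with respect to `emb y` is `Le_μ +` its centred offset (no wrap for `j + 2 ≤ m + K`).
[cite: Balaban1987RG1, (0.3)-(0.4) pp.252-253] -/
theorem rel_emb_blockSite_shift (hj2 : j + 2 ≤ P.m + P.K) (y : Site P (j + 1)) (μ : Fin P.d) (r : Fin P.d → Fin P.L) :
    rel (emb y) (Site.blockSite (y.shift μ) r) = ((P.L : ℕ) : ℤ) • e μ + off r := by
  rw [← transl_emb_off, ← transl_emb_seg, ← transl_add]
  refine rel_transl_of_mem _ _ fun ν => ?_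
  have hL : (2 : ℤ) * (((P.L - 1) / 2 : ℕ) : ℤ) + 1 = P.L := by exact_mod_cast AveragingRT.two_mul_half_add_one P
  have hn : (2 : ℤ) * ((P.L : ℤ) * P.L) ≤ (P.sitesPerDir j : ℤ) := by
    have := two_mul_sq_le_sitesPerDir hj2; rw [sq] at this; exact_mod_cast this
  have hb := off_bounds r ν
  have hL1 : (2 : ℤ) ≤ P.L := by exact_mod_cast P.hL.2
  have hLL : (2 : ℤ) * P.L ≤ (P.L : ℤ) * P.L := mul_le_mul_of_nonneg_right hL1 (by linarith)
  rw [Pi.add_apply, Pi.smul_apply, e_apply, smul_eq_mul]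
  split_ifs <;> constructor <;> nlinarith

/-- **A site of `B(c₋) ∪ B(c₊)` has its relative position (w.r.t. `emb c₋`) in the two-block box `[−h, h]ᵈ + [0, L]e_μ`** (`h = (L−1)∕2`; `j + 2 ≤ m + K`).
[cite: Balaban1987RG1, (0.3)-(0.4) pp.252-253] -/
theorem inBox_rel_of_twoBlock (hj : j + 1 ≤ P.m + P.K) (hj2 : j + 2 ≤ P.m + P.K) (c : PBond P (j + 1)) {x : Site P j}
    (hx : blockOf x = c.src ∨ blockOf x = c.tgt) :
    InBox (fun _ => -(((P.L - 1) / 2 : ℕ) : ℤ)) (fun ν => (if c.dir = ν then (P.L : ℤ) else 0) + (((P.L - 1) / 2 : ℕ) : ℤ)) (rel (emb c.src) x) := by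
  obtain ⟨r, hr⟩ : ∃ r : Fin P.d → Fin P.L, x = Site.blockSite (blockOf x) r := ⟨_, eq_blockSite_blockEquiv hj x⟩
  intro ν
  have hb := off_bounds r ν
  rcases hx with h | h
  · rw [h] at hr
    rw [hr, rel_emb_blockSite hj]
    dsimp only
    split_ifs <;> constructor <;> omega
  · rw [h] at hr
    rw [hr, PBond.tgt, rel_emb_blockSite_shift hj2, Pi.add_apply, Pi.smul_apply, e_apply, smul_eq_mul]
    dsimp only
    by_cases hν : c.dir = ν
    · subst hν; rw [if_pos rfl, if_pos rfl]; push_cast; constructor <;> omega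
    · rw [if_neg hν, if_neg (Ne.symm hν)]; push_cast; constructor <;> omega

/-- **No wrap-around on the two-block box**: for `z` in the box and any axis `μ`, `2(z_μ + 1) ≤` the period (`j + 2 ≤ m + K`). [cite: Balaban1987RG1, (0.1) p.251] -/
theorem noWrap_of_inBox (hj2 : j + 2 ≤ P.m + P.K) (c : PBond P (j + 1)) {z : LSite P.d}
    (hz : InBox (fun _ => -(((P.L - 1) / 2 : ℕ) : ℤ)) (fun ν => (if c.dir = ν then (P.L : ℤ) else 0) + (((P.L - 1) / 2 : ℕ) : ℤ)) z) (μ : Fin P.d) :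
    (z μ + 1) * 2 ≤ (P.sitesPerDir j : ℤ) := by
  have hL : (2 : ℤ) * (((P.L - 1) / 2 : ℕ) : ℤ) + 1 = P.L := by exact_mod_cast AveragingRT.two_mul_half_add_one P
  have hn : (2 : ℤ) * ((P.L : ℤ) * P.L) ≤ (P.sitesPerDir j : ℤ) := by
    have := two_mul_sq_le_sitesPerDir hj2; rw [sq] at this; exact_mod_cast this
  have hL1 : (2 : ℤ) ≤ P.L := by exact_mod_cast P.hL.2
  have h := (hz μ).2
  dsimp only at h
  -- `3L + 1 ≤ 2L²` for `L ≥ 2`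
  have hLL : (3 : ℤ) * P.L + 1 ≤ 2 * ((P.L : ℤ) * P.L) := by nlinarith [mul_le_mul_of_nonneg_right hL1 (by linarith : (0 : ℤ) ≤ P.L - 2)]
  split_ifs at h <;> nlinarith

/-- For a bond with both ends in the two blocks the relative position of its target is that of its source displaced by `e_μ` (no wrap).
[cite: Balaban1987RG1, (0.3) p.252] -/
theorem rel_tgt_of_twoBlock (hj : j + 1 ≤ P.m + P.K) (hj2 : j + 2 ≤ P.m + P.K) (c : PBond P (j + 1)) (b : PBond P j)
    (h1 : blockOf b.src = c.src ∨ blockOf b.src = c.tgt) : rel (emb c.src) b.tgt = rel (emb c.src) b.src + e b.dir :=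
  rel_shift_of_le _ _ _ (noWrap_of_inBox hj2 c (inBox_rel_of_twoBlock hj hj2 c h1) b.dir)

end Geometry

/-! ## §2 The torus axial gauge based at `emb c₋` on the two-block box -/

section Gauge

variable {𝔸 : Type*} [NormedRing 𝔸] [NormOneClass 𝔸]

/-- The axial gauge transformation of a globally bi-contractive field is bi-contractive (a holonomy). [cite: Balaban1985Averaging, (8)-(9) pp.18-19, p.24] -/
theorem axialT_mem_U1 {V : GaugeField P j 𝔸ˣ} (hV : ∀ b, V b ∈ U1 𝔸) (y x : Site P j) : axialT V y x ∈ U1 𝔸 := by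
  rw [axialT, ← hol_pull_zero]
  exact hol_mem (fun z κ => by rw [pull_apply]; exact hV _) 0 _

omit [NormedRing 𝔸] [NormOneClass 𝔸] in
/-- Two fields agreeing on the bonds with both ends in `B(c₋) ∪ B(c₊)` have pullbacks (based at `emb c₋`) agreeing on the two-block box. [cite: Balaban1987RG1, (0.3) p.252] -/
theorem agreeOn_pull_of_twoBlock {G : Type*} [Group G] (hj : j + 1 ≤ P.m + P.K) (c : PBond P (j + 1)) {V V' : GaugeField P j G}
    (h : ∀ b : PBond P j, (blockOf b.src = c.src ∨ blockOf b.src = c.tgt) → (blockOf b.tgt = c.src ∨ blockOf b.tgt = c.tgt) → V b = V' b) :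
    AgreeOn (fun _ => -(((P.L - 1) / 2 : ℕ) : ℤ)) (fun ν => (if c.dir = ν then (P.L : ℤ) else 0) + (((P.L - 1) / 2 : ℕ) : ℤ))
      (pull V (emb c.src)) (pull V' (emb c.src)) := fun z κ hz hzκ => by
  rw [pull_apply, pull_apply]
  refine h _ (blockOf_transl_emb hj c (fun ν => hz ν)) ?_
  rw [PBond.tgt, ← transl_add_e]
  exact blockOf_transl_emb hj c (fun ν => hzκ ν)

omit [NormedRing 𝔸] [NormOneClass 𝔸] in
/-- **The axial gauge based at `emb c₋`, evaluated on the two blocks, reads only the two-block bonds** (the comb `Γ_{emb c₋, x}` stays in the box;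
`B7Prop1Local.hol_treeWord_congr` on the pullbacks). [cite: Balaban1985Averaging, p.24] -/
theorem axialT_congr_of_twoBlock {G : Type*} [Group G] (hj : j + 1 ≤ P.m + P.K) (hj2 : j + 2 ≤ P.m + P.K) (c : PBond P (j + 1))
    {V V' : GaugeField P j G}
    (h : ∀ b : PBond P j, (blockOf b.src = c.src ∨ blockOf b.src = c.tgt) → (blockOf b.tgt = c.src ∨ blockOf b.tgt = c.tgt) → V b = V' b)
    {x : Site P j} (hx : blockOf x = c.src ∨ blockOf x = c.tgt) : axialT V (emb c.src) x = axialT V' (emb c.src) x := by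
  rw [axialT, axialT, ← hol_pull_zero, ← hol_pull_zero]
  have h0 : InBox (fun _ => -(((P.L - 1) / 2 : ℕ) : ℤ)) (fun ν => (if c.dir = ν then (P.L : ℤ) else 0) + (((P.L - 1) / 2 : ℕ) : ℤ)) (0 : LSite P.d) :=
    fun ν => by dsimp only; simp only [Pi.zero_apply]; split_ifs <;> omega
  have hx' := inBox_rel_of_twoBlock hj hj2 c hx
  exact hol_treeWord_congr (agreeOn_pull_of_twoBlock hj c h) 0 _ h0 (by rw [zero_add]; exact hx')

/-- ★ **THE AXIAL GAUGE MAKES THE TWO-BLOCK BOND VARIABLES SMALL FROM THE TWO-BLOCK PLAQUETTES** ([Balaban1985Averaging] pp. 24–25 «|V₀,b − 1| < |b₋ − y|α₀»,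
torus form): for a GLOBALLY bi-contractive `V` (apply to the factor cut off to `1` off the two blocks) whose plaquettes with all four corners in
`B(c₋) ∪ B(c₊)` are within `α` of `1`, every bond `b` with both ends in the two blocks has `‖V^{v₀}(b) − 1‖ ≤ ((d+2)L∕2)·α`, `v₀ = axialT V (emb c₋)`
(`|b₋ − emb c₋|₁ ≤ (d+2)L∕2` on the box; `j + 2 ≤ m + K`). [cite: Balaban1985Averaging, pp.24-25; Balaban1985UV3, (27) p.263] -/
theorem norm_gaugeU_axialT_sub_one_le_of_twoBlock (hj : j + 1 ≤ P.m + P.K) (hj2 : j + 2 ≤ P.m + P.K) {V : GaugeField P j 𝔸ˣ} (hV : ∀ b, V b ∈ U1 𝔸)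
    (c : PBond P (j + 1)) {α : ℝ} (hα : 0 ≤ α)
    (hplaq : ∀ p : Plaq P j, (blockOf p.src = c.src ∨ blockOf p.src = c.tgt) →
      (blockOf (p.src.shift p.μ) = c.src ∨ blockOf (p.src.shift p.μ) = c.tgt) →
      (blockOf (p.src.shift p.ν) = c.src ∨ blockOf (p.src.shift p.ν) = c.tgt) →
      (blockOf ((p.src.shift p.μ).shift p.ν) = c.src ∨ blockOf ((p.src.shift p.μ).shift p.ν) = c.tgt) →
      ‖((plaq V p : 𝔸ˣ) : 𝔸) - 1‖ ≤ α)
    (b : PBond P j) (h1 : blockOf b.src = c.src ∨ blockOf b.src = c.tgt) (h2 : blockOf b.tgt = c.src ∨ blockOf b.tgt = c.tgt) :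
    ‖((gaugeU (axialT V (emb c.src)) V b : 𝔸ˣ) : 𝔸) - 1‖ ≤ ((((P.d + 2) * P.L : ℕ) : ℝ) / 2) * α := by
  have hsrc := inBox_rel_of_twoBlock hj hj2 c h1
  have htgt : InBox (fun _ => -(((P.L - 1) / 2 : ℕ) : ℤ)) (fun ν => (if c.dir = ν then (P.L : ℤ) else 0) + (((P.L - 1) / 2 : ℕ) : ℤ))
      (rel (emb c.src) b.src + e b.dir) := by
    rw [← rel_tgt_of_twoBlock hj hj2 c b h1]; exact inBox_rel_of_twoBlock hj hj2 c h2
  have h0 : InBox (fun _ => -(((P.L - 1) / 2 : ℕ) : ℤ)) (fun ν => (if c.dir = ν then (P.L : ℤ) else 0) + (((P.L - 1) / 2 : ℕ) : ℤ)) (0 : LSite P.d) :=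
    fun ν => by dsimp only; simp only [Pi.zero_apply]; split_ifs <;> omega
  -- the gauged bond variable is the holonomy of the contour of (27)
  have heq : gaugeU (axialT V (emb c.src)) V b = holT V (emb c.src) (B10Eq27TorusAxialLog.contourT (emb c.src) b) := by
    rw [holT_contourT_eq_gaugeActT V (emb c.src) b (noWrap_of_inBox hj2 c hsrc b.dir), gaugeActT_apply]; rfl
  rw [heq]
  -- the local plaquette hypothesis for the pullback
  have h13 : ∀ (z : LSite P.d) (κ μ : Fin P.d), κ ≠ μ →
      PlaqIn (fun _ => -(((P.L - 1) / 2 : ℕ) : ℤ)) (fun ν => (if c.dir = ν then (P.L : ℤ) else 0) + (((P.L - 1) / 2 : ℕ) : ℤ)) (z, κ, μ) →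
      ‖((holT V (transl (emb c.src) z) (plaqWord κ μ) : 𝔸ˣ) : 𝔸) - 1‖ ≤ α := fun z κ μ hκμ hp => by
    rw [← hol_pull]
    exact norm_hol_pull_plaqWord_sub_one_le_of_twoBlock hj c (fun b' _ _ => hV b') hplaq z κ μ hκμ hp
  have hmain := norm_holT_contourT_sub_one_le (twoBlockBox_lo_le_hi c) V hV (emb c.src) h13 hα h0 b hsrc htgt
  refine hmain.trans (mul_le_mul_of_nonneg_right ?_ hα)
  have h2l : (2 : ℝ) * (l1 (rel (emb c.src) b.src) : ℝ) ≤ (((P.d + 2) * P.L : ℕ) : ℝ) := by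
    exact_mod_cast two_mul_l1_le_of_inBox c (fun ν => hsrc ν)
  linarith

end Gauge

/-! ## §3 The C⁰ comb letter in the axial gauge of the factor -/

section Letter

variable {n : Type*} [Fintype n] [DecidableEq n] [Nonempty n]

/-- ★★ **THE C⁰ COMB LETTER IN THE TORUS AXIAL GAUGE OF THE FACTOR — two-block-local hypotheses, no free gauge.**  Let `c` be a coarse bond of `T^{(j+1)}`
(`j + 2 ≤ m + K`), `𝐔 = (exp iηA′)·U` on the bonds with both ends in `B(c₋) ∪ B(c₊)` (run B's (1.10)–(1.11) factorisation), `|A′| ≤ a` and `U ∈ U1` (e.g.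
`SU(N)`-valued) there, `‖∂U(p) − 1‖ ≤ α` for the plaquettes with all four corners there, `((d+2)L∕2)·α ≤ t`, and p624650's numerics (`ηa ≤ 1∕2`,
`136ℓ((2ηa + t + 2ηa·t) + t) ≤ 1`).  Then, with `v₀ = axialT U (emb c₋)` THE AXIAL GAUGE OF THE FACTOR (`v₀(emb c₋) = 1`) and `Ã′ = Ad(v₀)A′`,
`‖(iξ)⁻¹ log(Ū(𝐔)(c)·Ū(U)(c)⁻¹) + (η∕ξ)·(λ̄_{Ã′}(c₊) − λ̄_{Ã′}(c₋))‖ ≤ (η∕ξ)·L·a + R∕ξ` with p624650's second-order `R` — leading coefficient `ηL∕ξ = 1` on the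
`α₁`-radius.  Proof: p624650 ★★★ for the fields cut off AFTER gauging by `axialT` of the cut-off factor (§2 ★ on the box bonds, `1` elsewhere), two-block
locality of `Ū(c)` (UST `emlAvgU_congr₂`) and of `λ̄(c_±)` (g2 `combMean_congr_block`), exact covariance `Ū(𝐔^{v})Ū(U^{v})⁻¹ = v₋[Ū(𝐔)Ū(U)⁻¹]v₋⁻¹`
(p626630) with `v₋ = v₀(emb c₋) = 1`. [cite: Balaban1985Averaging, (8)-(11) pp.18-19, pp.24-25, Prop. 3 (62)-(63) p.28, (122)-(126) p.36; Balaban1987RG1, (0.4) p.253, (1.10)-(1.13) p.262] -/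
theorem norm_potential_add_combGrad_le_axial (hj : j + 1 ≤ P.m + P.K) (hj2 : j + 2 ≤ P.m + P.K) (c : PBond P (j + 1))
    {Uc U : GaugeField P j (Matrix n n ℂ)ˣ} {A : PBond P j → Matrix n n ℂ} {η ξ a α t : ℝ} (hη : 0 ≤ η) (hξ : 0 < ξ) (ha0 : 0 ≤ a) (hα : 0 ≤ α)
    (hf : ∀ b : PBond P j, (blockOf b.src = c.src ∨ blockOf b.src = c.tgt) → (blockOf b.tgt = c.src ∨ blockOf b.tgt = c.tgt) →
      Uc b = expI η (A b) * U b)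
    (hA : ∀ b : PBond P j, (blockOf b.src = c.src ∨ blockOf b.src = c.tgt) → (blockOf b.tgt = c.src ∨ blockOf b.tgt = c.tgt) → ‖A b‖ ≤ a)
    (hηa : η * a ≤ 1 / 2)
    (hU1 : ∀ b : PBond P j, (blockOf b.src = c.src ∨ blockOf b.src = c.tgt) → (blockOf b.tgt = c.src ∨ blockOf b.tgt = c.tgt) →
      U b ∈ U1 (Matrix n n ℂ))
    (hplaq : ∀ p : Plaq P j, (blockOf p.src = c.src ∨ blockOf p.src = c.tgt) →
      (blockOf (p.src.shift p.μ) = c.src ∨ blockOf (p.src.shift p.μ) = c.tgt) →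
      (blockOf (p.src.shift p.ν) = c.src ∨ blockOf (p.src.shift p.ν) = c.tgt) →
      (blockOf ((p.src.shift p.μ).shift p.ν) = c.src ∨ blockOf ((p.src.shift p.μ).shift p.ν) = c.tgt) →
      ‖((plaq U p : (Matrix n n ℂ)ˣ) : Matrix n n ℂ) - 1‖ ≤ α)
    (hRt : ((((P.d + 2) * P.L : ℕ) : ℝ) / 2) * α ≤ t)
    (hℓ : 136 * (((P.d + 2) * P.L : ℕ) : ℝ) * ((2 * (η * a) + t + 2 * (η * a) * t) + t) ≤ 1) :
    ‖(I * (ξ : ℂ))⁻¹ • mlog (((avgUnits Uc c : (Matrix n n ℂ)ˣ) : Matrix n n ℂ) * (((avgUnits U c)⁻¹ : (Matrix n n ℂ)ˣ) : Matrix n n ℂ)) +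
        ((η / ξ : ℝ) : ℂ) • (combMean (adJ (axialT U (emb c.src)) A) c.tgt - combMean (adJ (axialT U (emb c.src)) A) c.src)‖ ≤
      η / ξ * ((P.L : ℝ) * a) +
      (4 * (34 * (((P.d + 2) * P.L : ℕ) : ℝ) * ((2 * (η * a) + t + 2 * (η * a) * t) + t)) ^ 2 +
        578 * (((P.d + 2) * P.L : ℕ) : ℝ) ^ 2 * ((2 * (η * a) + t + 2 * (η * a) * t) + t) * t +
        660 * (((P.d + 2) * P.L : ℕ) : ℝ) ^ 2 * ((2 * (η * a) + t + 2 * (η * a) * t) ^ 2 + t ^ 2) +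
        3 * (((P.d + 2) * P.L : ℕ) : ℝ) * (2 * (η * a) * t) + 3 * (((P.d + 2) * P.L : ℕ) : ℝ) * (η * a) ^ 2) / ξ := by
  classical
  have ht0 : 0 ≤ t := le_trans (by positivity) hRt
  -- the two-block predicate (blocks) and the box predicate (relative positions); the former implies the latter
  let χ : PBond P j → Prop := fun b => (blockOf b.src = c.src ∨ blockOf b.src = c.tgt) ∧ (blockOf b.tgt = c.src ∨ blockOf b.tgt = c.tgt)
  -- the cut-off fields (before gauging): globally `U1`, factorised everywhere
  let U' : GaugeField P j (Matrix n n ℂ)ˣ := fun b => if χ b then U b else 1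
  let Uc' : GaugeField P j (Matrix n n ℂ)ˣ := fun b => if χ b then Uc b else 1
  let A' : PBond P j → Matrix n n ℂ := fun b => if χ b then A b else 0
  have hU'U : ∀ b : PBond P j, (blockOf b.src = c.src ∨ blockOf b.src = c.tgt) → (blockOf b.tgt = c.src ∨ blockOf b.tgt = c.tgt) → U' b = U b :=
    fun b h1 h2 => by simp only [U', χ, if_pos (And.intro h1 h2)]
  have hUU' : ∀ b : PBond P j, (blockOf b.src = c.src ∨ blockOf b.src = c.tgt) → (blockOf b.tgt = c.src ∨ blockOf b.tgt = c.tgt) → U b = U' b :=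
    fun b h1 h2 => (hU'U b h1 h2).symm
  have hUcUc' : ∀ b : PBond P j, (blockOf b.src = c.src ∨ blockOf b.src = c.tgt) → (blockOf b.tgt = c.src ∨ blockOf b.tgt = c.tgt) → Uc b = Uc' b :=
    fun b h1 h2 => by simp only [Uc', χ, if_pos (And.intro h1 h2)]
  have hU'1 : ∀ b, U' b ∈ U1 (Matrix n n ℂ) := fun b => by
    by_cases hb : χ b
    · simp only [U', if_pos hb]; exact hU1 b hb.1 hb.2
    · simp only [U', if_neg hb]; exact (U1 _).one_mem
  have hf' : ∀ b, Uc' b = expI η (A' b) * U' b := fun b => by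
    by_cases hb : χ b
    · simp only [Uc', U', A', if_pos hb]; exact hf b hb.1 hb.2
    · simp only [Uc', U', A', if_neg hb, expI_zero, one_mul]
  have hA' : ∀ b, ‖A' b‖ ≤ a := fun b => by
    by_cases hb : χ b
    · simp only [A', if_pos hb]; exact hA b hb.1 hb.2
    · simp only [A', if_neg hb, norm_zero]; exact ha0
  have hplaq' : ∀ p : Plaq P j, (blockOf p.src = c.src ∨ blockOf p.src = c.tgt) →
      (blockOf (p.src.shift p.μ) = c.src ∨ blockOf (p.src.shift p.μ) = c.tgt) →
      (blockOf (p.src.shift p.ν) = c.src ∨ blockOf (p.src.shift p.ν) = c.tgt) →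
      (blockOf ((p.src.shift p.μ).shift p.ν) = c.src ∨ blockOf ((p.src.shift p.μ).shift p.ν) = c.tgt) →
      ‖((plaq U' p : (Matrix n n ℂ)ˣ) : Matrix n n ℂ) - 1‖ ≤ α := fun p c1 c2 c3 c4 => by
    have hpe : plaq U' p = plaq U p := by
      rw [plaq_eq, plaq_eq, hU'U ⟨p.src, p.μ⟩ c1 c2, hU'U ⟨p.src.shift p.μ, p.ν⟩ c2 c4, hU'U ⟨p.src, p.ν⟩ c1 c3,
        hU'U ⟨p.src.shift p.ν, p.μ⟩ c3 (by rw [PBond.tgt, Site.shift_comm]; exact c4)]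
    rw [hpe]; exact hplaq p c1 c2 c3 c4
  -- the axial gauge of the cut-off factor: globally `U1`, `= 1` at the centre, `= axialT U (emb c₋)` on the two blocks
  set v : Site P j → (Matrix n n ℂ)ˣ := axialT U' (emb c.src) with hvdef
  have hv1 : ∀ x, v x ∈ U1 (Matrix n n ℂ) := fun x => axialT_mem_U1 hU'1 _ x
  have hv0 : v (emb c.src) = 1 := axialT_self U' (emb c.src)
  have hvU : ∀ x : Site P j, (blockOf x = c.src ∨ blockOf x = c.tgt) → v x = axialT U (emb c.src) x := fun x hx =>
    axialT_congr_of_twoBlock hj hj2 c hU'U hx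
  -- cut off AFTER gauging: the near-identity factorised triple on ALL bonds
  let U₀ : GaugeField P j (Matrix n n ℂ)ˣ := fun b => if χ b then gaugeU v U' b else 1
  let S₀ : GaugeField P j (Matrix n n ℂ)ˣ := fun b => if χ b then gaugeU v Uc' b else 1
  let A₀ : PBond P j → Matrix n n ℂ := fun b => if χ b then adJ v A' b else 0
  have hS : ∀ b, S₀ b = expI η (A₀ b) * U₀ b := fun b => by
    by_cases hb : χ b
    · simp only [S₀, U₀, A₀, if_pos hb]; exact gaugeU_factors hf' v b
    · simp only [S₀, U₀, A₀, if_neg hb, expI_zero, one_mul]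
  have hA₀ : ∀ b, ‖A₀ b‖ ≤ a := fun b => by
    by_cases hb : χ b
    · simp only [A₀, if_pos hb]; exact norm_adJ_le_of_U1 hv1 hA' b
    · simp only [A₀, if_neg hb, norm_zero]; exact ha0
  have hU₀ : ∀ b, ‖((U₀ b : (Matrix n n ℂ)ˣ) : Matrix n n ℂ) - 1‖ ≤ t := fun b => by
    by_cases hb : χ b
    · simp only [U₀, if_pos hb]
      exact (norm_gaugeU_axialT_sub_one_le_of_twoBlock hj hj2 hU'1 c hα hplaq' b hb.1 hb.2).trans hRt
    · simp only [U₀, if_neg hb, Units.val_one, sub_self, norm_zero]; exact ht0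
  -- p624650 ★★★ for the cut-off gauged triple
  have h9 := norm_potential_add_combGrad_le hj hη hξ hS ha0 hA₀ hηa ht0 hU₀ hℓ c
  -- two-block locality of the averages and exact covariance, with `v(emb c₋) = 1`
  have hS₀loc : avgUnits S₀ c = avgUnits (gaugeU v Uc') c :=
    (emlAvgU_congr₂ hj c fun b h1 h2 => by simp only [S₀, χ, if_pos (And.intro h1 h2)]).symm
  have hU₀loc : avgUnits U₀ c = avgUnits (gaugeU v U') c :=
    (emlAvgU_congr₂ hj c fun b h1 h2 => by simp only [U₀, χ, if_pos (And.intro h1 h2)]).symm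
  have hquot : ((avgUnits S₀ c : (Matrix n n ℂ)ˣ) : Matrix n n ℂ) * (((avgUnits U₀ c)⁻¹ : (Matrix n n ℂ)ˣ) : Matrix n n ℂ) =
      ((avgUnits Uc c : (Matrix n n ℂ)ˣ) : Matrix n n ℂ) * (((avgUnits U c)⁻¹ : (Matrix n n ℂ)ˣ) : Matrix n n ℂ) := by
    have hUc'loc : avgUnits Uc' c = avgUnits Uc c := (emlAvgU_congr₂ hj c hUcUc').symm
    have hU'loc : avgUnits U' c = avgUnits U c := (emlAvgU_congr₂ hj c hUU').symm
    rw [hS₀loc, hU₀loc, ← Units.val_mul, avgUnits_mul_inv_gaugeU, hv0, one_mul, inv_one, mul_one, Units.val_mul, hUc'loc, hU'loc]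
  -- two-block locality of the comb means, `A′ = A`, `v = axialT U (emb c₋)` on the two blocks
  have hA₀A : ∀ (y : Site P (j + 1)), (y = c.src ∨ y = c.tgt) → combMean A₀ y = combMean (adJ (axialT U (emb c.src)) A) y := fun y hy => by
    refine combMean_congr_block hj y fun b h1 h2 => ?_
    have h1' : blockOf b.src = c.src ∨ blockOf b.src = c.tgt := by rcases hy with h | h <;> [exact Or.inl (h1.trans h); exact Or.inr (h1.trans h)]
    have h2' : blockOf b.tgt = c.src ∨ blockOf b.tgt = c.tgt := by rcases hy with h | h <;> [exact Or.inl (h2.trans h); exact Or.inr (h2.trans h)]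
    simp only [A₀, A', χ, if_pos (And.intro h1' h2'), adJ, hvU b.src h1']
  rw [hquot, hA₀A c.tgt (Or.inr rfl), hA₀A c.src (Or.inl rfl)] at h9
  exact h9

end Letter

end YMDAG.N18.TransportOfRecord

end
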